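import Mathlib

/-!
# SoloBlindBlockArithmetic — the arithmetic skeleton of the block theorems for Galois Albanese carriers

Solo-blind session s31 (work/s31/galois-carriers-II.md).  For a Galois Albanese carrier of a K3
surface with carrying block `π`, multiplicities `a_τ`, `s = Σ a_τ²`, `d = h^{2,0}(N)`,
`h = h^{1,1}(N₀)`, multiplicity `J` of `T` in `N = H²(A,ℚ)^G`, and `r = rank T`, the Hodge-theoretic
part of the argument produces the raw inequalities recorded as hypotheses below; this file certifies
the purely arithmetic consequences that the text uses:

* `rank_bound`      : `r + 1 ≤ (2d + s) − (2(d−1) + h)` gives `r ≤ 1 + s − h`            (Thm B(1));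
* `mult_bound`      : with `h ≥ (J−1)(r−2)` one gets `J (r−2) ≤ s − 1`                    (Thm B(3));
* `cyclic_bound`    : `e (r−2) ≤ e (m²−2) − 1`, `e ≥ 1` gives `r ≤ m² − 1`                 (§4(a));
* `sympl_block_one`, `orth_block_one`, `cplx_block_one` : the blocks with exactly one invariant
  2-form (`a(a+1)=2`, `a(a−1)=2`, `ab=1`) have multiplicities `1`, `2`, `(1,1)`, whence the rank
  bounds `2`, `5`, `3` of Thm D1 (`d1_rank_cases`);
* `t8_quaternionic_mult` : on the T₈ face `4m ≥ 32` forces `m ≥ 8`, outside the open residue `{3,4}`.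
-/

namespace Summit.HodgeConjecture.HodgeConjecture.Theorems.SoloBlindBlockArithmetic

/-- Thm B(1): from `rank a^*(N) ≥ r+1`, `rank N = 2d+s`, `rank N₀ = 2(d-1)+h`. -/
theorem rank_bound (r d s h : ℤ) (H : r + 1 ≤ (2 * d + s) - (2 * (d - 1) + h)) :
    r ≤ 1 + s - h := by
  omega

/-- Thm B(3): the `J-1` extra copies of `T` inside `N₀` contribute `(J-1)(r-2)` to `h^{1,1}(N₀)`. -/
theorem mult_bound (r s h J : ℤ) (hr : r ≤ 1 + s - h) (hh : (J - 1) * (r - 2) ≤ h) :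
    J * (r - 2) ≤ s - 1 := by
  nlinarith [hr, hh]

/-- §4(a): cyclic carrying block with `e = φ(n)/2 ≥ 1` conjugate pairs and `m` copies of `ℚ(ζ_n)`. -/
theorem cyclic_bound (r m e : ℤ) (he : 1 ≤ e) (H : e * (r - 2) ≤ e * (m ^ 2 - 2) - 1) :
    r ≤ m ^ 2 - 1 := by
  by_contra hc
  push Not at hc
  have h1 : e * (m ^ 2 - 2) ≤ e * (r - 2) := by
    apply mul_le_mul_of_nonneg_left <;> linarith
  linarith

/-- `m ≤ 2` copies of `ℚ(ζ_n)`: `r ≤ 3`. -/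
theorem cyclic_two_copies (r m e : ℤ) (he : 1 ≤ e) (hm : m ≤ 2) (hm0 : 0 ≤ m)
    (H : e * (r - 2) ≤ e * (m ^ 2 - 2) - 1) : r ≤ 3 := by
  have := cyclic_bound r m e he H
  nlinarith

/-- Symplectic constituent: one invariant form iff `a(a+1)/2 = 1` iff `a = 1`. -/
theorem sympl_block_one (a : ℕ) (h : a * (a + 1) = 2) : a = 1 := by
  have : a ≤ 2 := by nlinarith
  interval_cases a <;> omega

/-- Orthogonal constituent: one invariant form iff `a(a-1)/2 = 1` iff `a = 2`. -/
theorem orth_block_one (a : ℕ) (h : a * (a - 1) = 2) : a = 2 := by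
  have : a ≤ 2 := by
    by_contra hc
    push Not at hc
    have h1 : 2 ≤ a - 1 := by omega
    have h2 : 3 * 2 ≤ a * (a - 1) := Nat.mul_le_mul (by omega) h1
    omega
  interval_cases a <;> omega

/-- Complex pair: one invariant form iff `a·ā = 1` iff `(a,ā) = (1,1)`. -/
theorem cplx_block_one (a b : ℕ) (h : a * b = 1) : a = 1 ∧ b = 1 := by
  have ha : a ≤ 1 := by
    rcases Nat.eq_zero_or_pos b with hb | hb
    · subst hb; simp at h
    · nlinarith
  have hb : b ≤ 1 := by
    rcases Nat.eq_zero_or_pos a with ha' | ha'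
    · subst ha'; simp at h
    · nlinarith
  interval_cases a <;> interval_cases b <;> simp_all

/-- Thm D1: with one block and one invariant form, `r ≤ 1 + Σa²` is `≤ 2`, `≤ 5`, `≤ 3` in the
symplectic / orthogonal / complex cases respectively. -/
theorem d1_rank_cases (r : ℕ) :
    (∀ a : ℕ, a * (a + 1) = 2 → r ≤ 1 + a ^ 2 → r ≤ 2) ∧
    (∀ a : ℕ, a * (a - 1) = 2 → r ≤ 1 + a ^ 2 → r ≤ 5) ∧
    (∀ a b : ℕ, a * b = 1 → r ≤ 1 + (a ^ 2 + b ^ 2) → r ≤ 3) := by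
  refine ⟨?_, ?_, ?_⟩
  · intro a h hr; have := sympl_block_one a h; subst this; simpa using hr
  · intro a h hr; have := orth_block_one a h; subst this; simpa using hr
  · intro a b h hr
    obtain ⟨rfl, rfl⟩ := cplx_block_one a b h
    simpa using hr

/-- T₈ corollary: a quaternionic carrying block containing `A₊ × A₋` (`dim H¹ = 4m ≥ 32`) has
`m ≥ 8`, outside the open residue `m ∈ {3,4}`. -/
theorem t8_quaternionic_mult (m : ℕ) (h : 32 ≤ 4 * m) : 8 ≤ m ∧ m ≠ 3 ∧ m ≠ 4 := by
  omega

end Summit.HodgeConjecture.HodgeConjecture.Theorems.SoloBlindBlockArithmetic
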